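import Summits.BirchSwinnertonDyer.Rank1Residual.GaloisImage.MultiplicativeCartanNormalizer
import HarnessLib

/-!
# BSD rank-≤1 residual cell: at a MULTIPLICATIVE prime `p ≥ 5` the mod-`p` image contains a split
# half-Cartan subgroup and meets NO non-split Cartan normaliser — for every elliptic curve over `ℚ`

HONEST FRAMING (cell `b2b-bsdres-*`, run/shared/lean/b2b/bsd-rank1-residual/, verbatim): the goal
of the cell is to DELETE the COMBINATION-SHAPED residual classes for ALL analytic-rank `≤ 1` elliptic
curves over `ℚ` — "full BSD formula for every rank `≤ 1` curve in class C" assembled STRICTLY from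
published theorems — so that the rank-`≤ 1` remainder becomes exactly the CONSTRUCTION-SHAPED
classes, which are TYPED (missing-input Props), NOT attempted; this is not "finishing BSD".
Prove what is provable now; shrink each hard class to its core with data; no claim beyond stated
classes. Unit `b2b-bsdres-x11c` (gen 7). Theorems only (no definition, no named fact); TOOL file,
sequel of `MultiplicativeCartanNormalizer.lean` (whose theorems assume `Irr ∧ ¬Surj`): here the
SAME inertia line (Serre 1972 §1.12) is used with NO hypothesis on the image.

* `exists_halfSplitCartan_le_image_of_mult` — at a multiplicative `p ≠ 2` the image
  `G = Φ(ρ̄_{E,p}(Γ_ℚ))` contains a split half-Cartan subgroup `P (1 0; 0 *) P⁻¹` (Serre §1.11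
  Cor. of Prop. 11 (b)–(c), transported by `Serre1972.exists_halfSplitCartan_le_map`).
* `not_le_normalizer_unitGroup_of_mult` — at a multiplicative `p ≥ 5`, `G ⊄ N(kˣ)` for every
  subfield `k ⊆ M₂(𝔽_p)` of degree `2` (Prop. 14: a Cartan subgroup normalised by a split
  half-Cartan subgroup is split; a non-split `kˣ` has no non-scalar element with eigenvalue `1`).
  In Sutherland's labels: image type `pNn` NEVER occurs at a prime `p ≥ 5` of multiplicative
  reduction; equivalently a curve whose mod-`p` image lies in the normaliser of a non-split Cartan
  subgroup (a non-cuspidal point of `X_ns⁺(p)`, the open side of Serre's uniformity question —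
  `Literature/NumberTheory/SerreUniformity/Statement.lean`) does not have multiplicative reduction
  at `p`.  The multiplicative twin of `X9ImageShape`'s `not_le_normalizer_unitGroup_of_goodOrd`.
* `exists_frame_forall_not_le_normalizer_unitGroup_of_mult` — frame-free packaging.

Data (Cremona `N < 5·10⁵`, this gen's `galrep_mult_scan.py`): at `p ∥ N`, `p ≥ 5`, the
non-surjective image codes are `5B`, `5Ns` (= split Cartan normaliser), `5S4`, `7B` only — no
`pNn`, as the theorem predicts.

## References

* [SerreInventiones1972] J.-P. Serre, Invent. Math. 15 (1972), §1.11 (Prop. 11, Cor.), §1.12,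
  §2.2 (Prop. 14).
-/

noncomputable section

open scoped Classical NumberField
open IsDedekindDomain Field Matrix NumberField
open WeierstrassCurve Literature.NumberTheory.EllipticCurves Literature.NumberTheory.GaloisRepresentations
  Literature.NumberTheory.GaloisRepresentations.Serre1972 Rat.HeightOneSpectrum
  Literature.NumberTheory.EllipticCurves.Rank1Residual

namespace Summit.BirchSwinnertonDyer.Rank1Residual.GaloisImage

variable (W : WeierstrassCurve ℚ) [W.IsElliptic] (p : ℕ) [hp : Fact p.Prime]

section FrameAny

variable (Φ : Multiplicative (AddAut (geomTorsion W p)) ≃* GL (Fin 2) (ZMod p))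
  (e : geomTorsion W p ≃+ (Fin 2 → ZMod p))
  (he : ∀ (g : Multiplicative (AddAut (geomTorsion W p))) (x : geomTorsion W p),
    e (Multiplicative.toAdd g x) =
      ((Φ g : GL (Fin 2) (ZMod p)) : Matrix (Fin 2) (Fin 2) (ZMod p)) *ᵥ e x)

include he in
/-- **At a multiplicative `p ≠ 2` the image `G = Φ(ρ̄_{E,p}(Γ_ℚ))` CONTAINS a split half-Cartan
subgroup `P (1 0; 0 *) P⁻¹`** — for EVERY elliptic curve over `ℚ`, with no hypothesis on the image
(Serre §1.12 with Cor. (b)–(c) of Prop. 11: the inertia line of `exists_inertia_line_of_mult`,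
transported by `Serre1972.exists_halfSplitCartan_le_map`; when `p ∣ #G` the inertia image may be
the whole `P (χ *; 0 1) P⁻¹`, which still contains a half-Cartan subgroup).
[cite: SerreInventiones1972, §1.12 and §1.11 Cor. of Prop. 11] -/
theorem exists_halfSplitCartan_le_image_of_mult (hp2 : p ≠ 2) (hmult : Mult W p) :
    ∃ P : GL (Fin 2) (ZMod p),
      halfSplitCartan P ≤ (galoisRepTorsion W p).range.map Φ.toMonoidHom := by
  letI : Module (ZMod p) (geomTorsion W p) := AddSubgroup.torsionBy.zmodModule
  have hpp : p.Prime := hp.out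
  set v : HeightOneSpectrum (𝓞 ℚ) := (primesEquiv (R := 𝓞 ℚ)).symm ⟨p, hpp⟩ with hvdef
  have hv' : primesEquiv v = ⟨p, hpp⟩ := Equiv.apply_symm_apply _ _
  have hv : (primesEquiv v : ℕ) = p := congrArg Subtype.val hv'
  obtain ⟨𝔏, h𝔏⟩ := HeightOneSpectrum.primesAbove_nonempty v
  obtain ⟨v₀, hv₀, hquot, hsurj⟩ := exists_inertia_line_of_mult W p hp2 hmult hv h𝔏
  set ρ := galoisRepTorsion W p with hρ
  obtain ⟨P, -, hP⟩ := exists_halfSplitCartan_le_map e Φ he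
    (I := (𝔏.inertia (absoluteGaloisGroup ℚ)).map ρ) hv₀
    (fun τ' ⟨τ, hτ, hτ'⟩ x ↦ by subst hτ'; exact hquot τ hτ x)
    (fun a ↦ by
      obtain ⟨τ, hτ, hτv⟩ := hsurj a
      exact ⟨ρ τ, ⟨τ, hτ, rfl⟩, hτv⟩)
  exact ⟨P, hP.trans (Subgroup.map_mono fun x ⟨τ, _, hτ⟩ ↦ ⟨τ, hτ⟩)⟩

include he in
/-- **At a multiplicative `p ≥ 5` the image is NOT contained in the normaliser of any non-split
Cartan subgroup `kˣ`** (image type `pNn` never occurs at a multiplicative prime `p ≥ 5`), for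
EVERY elliptic curve over `ℚ` — no irreducibility, surjectivity or CM hypothesis.  The half-Cartan
subgroup `P (1 0; 0 *) P⁻¹ ≤ G` (`exists_halfSplitCartan_le_image_of_mult`) inside `N(kˣ)` forces
`kˣ = P (* 0; 0 *) P⁻¹` by Prop. 14 (`eq_splitCartan_of_halfSplitCartan_le_normalizer`, `p ≥ 5`),
but `kˣ` contains no non-scalar element with eigenvalue `1` such as `P diag(1,u) P⁻¹`, `u ≠ 1`
(`forall_ne_zero_of_isField`: its characteristic polynomial has the root `1`).
[cite: SerreInventiones1972, §2.2 Prop. 14] -/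
theorem not_le_normalizer_unitGroup_of_mult (h5 : 5 ≤ p) (hmult : Mult W p)
    {k : Subalgebra (ZMod p) (Matrix (Fin 2) (Fin 2) (ZMod p))} (hk : IsField k)
    (h2 : Module.finrank (ZMod p) k = 2) :
    ¬ (galoisRepTorsion W p).range.map Φ.toMonoidHom ≤
        Subgroup.normalizer (unitGroup k : Set (GL (Fin 2) (ZMod p))) := by
  intro hGN
  have hp2 : p ≠ 2 := by omega
  obtain ⟨P, hCG⟩ := exists_halfSplitCartan_le_image_of_mult W p Φ e he hp2 hmult
  have hkC : unitGroup k ∈ cartanSubgroups (ZMod p) := unitGroup_mem_cartanSubgroups hk h2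
  have hCeq : unitGroup k = splitCartan P :=
    eq_splitCartan_of_halfSplitCartan_le_normalizer hkC h5 (hCG.trans hGN)
  obtain ⟨u, hu⟩ := exists_units_ne_one hp2
  have hmem : (MulAut.conj P).toMonoidHom (halfDiagonalHom u) ∈ unitGroup k := by
    rw [hCeq]
    exact halfSplitCartan_le_splitCartan P
      ⟨halfDiagonalHom u, by rw [← range_halfDiagonalHom]; exact ⟨u, rfl⟩, rfl⟩
  have hy : (((MulAut.conj P).toMonoidHom (halfDiagonalHom u) : GL (Fin 2) (ZMod p)) :
      Matrix (Fin 2) (Fin 2) (ZMod p)) ∈ k := mem_unitGroup_iff.mp hmem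
  have hys := conj_halfDiagonalHom_ne_smul_one P hu
  have hno := forall_ne_zero_of_isField hk hy hys
  apply hno 1
  have htr : Matrix.trace ((((MulAut.conj P).toMonoidHom (halfDiagonalHom u) : GL (Fin 2) (ZMod p)) :
      Matrix (Fin 2) (Fin 2) (ZMod p))) = 1 + (u : ZMod p) := by
    rw [MulEquiv.coe_toMonoidHom, MulAut.conj_apply, Units.val_mul, Units.val_mul,
      Matrix.trace_mul_cycle, Matrix.coe_units_inv, Matrix.nonsing_inv_mul _ (GL2.det_ne_zero P).isUnit,
      Matrix.one_mul, coe_halfDiagonalHom]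
    simp [Matrix.trace, Fin.sum_univ_two]
  have hdet : Matrix.det ((((MulAut.conj P).toMonoidHom (halfDiagonalHom u) : GL (Fin 2) (ZMod p)) :
      Matrix (Fin 2) (Fin 2) (ZMod p))) = (u : ZMod p) := by
    have h := det_halfDiagonalHom u
    have hPP : Matrix.det (P : Matrix (Fin 2) (Fin 2) (ZMod p)) *
        Matrix.det ((P : Matrix (Fin 2) (Fin 2) (ZMod p))⁻¹) = 1 := by
      rw [← Matrix.det_mul, Matrix.mul_nonsing_inv _ (GL2.det_ne_zero P).isUnit, Matrix.det_one]
    rw [MulEquiv.coe_toMonoidHom, MulAut.conj_apply, Units.val_mul, Units.val_mul, Matrix.det_mul,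
      Matrix.det_mul, Matrix.coe_units_inv, mul_comm (Matrix.det (P : Matrix (Fin 2) (Fin 2) (ZMod p))),
      mul_assoc, hPP, mul_one]
    have := congrArg (fun x : (ZMod p)ˣ ↦ (x : ZMod p)) h
    simpa [Matrix.GeneralLinearGroup.val_det_apply] using this
  rw [htr, hdet]
  ring

end FrameAny

/-- **Frame-free packaging**: at a multiplicative `p ≥ 5` there is a frame `(e, Φ)` of `E[p]`
(indeed every frame works) in which `G ⊄ N(kˣ)` for every subfield `k ⊆ M₂(𝔽_p)` of degree `2`.
[cite: SerreInventiones1972, §2.2 Prop. 14] -/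
theorem exists_frame_forall_not_le_normalizer_unitGroup_of_mult (h5 : 5 ≤ p) (hmult : Mult W p) :
    ∃ (e : geomTorsion W p ≃+ (Fin 2 → ZMod p))
      (Φ : Multiplicative (AddAut (geomTorsion W p)) ≃* GL (Fin 2) (ZMod p)),
      (∀ (g : Multiplicative (AddAut (geomTorsion W p))) (x : geomTorsion W p),
        e (Multiplicative.toAdd g x) =
          ((Φ g : GL (Fin 2) (ZMod p)) : Matrix (Fin 2) (Fin 2) (ZMod p)) *ᵥ e x) ∧
      ∀ (k : Subalgebra (ZMod p) (Matrix (Fin 2) (Fin 2) (ZMod p))), IsField k →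
        Module.finrank (ZMod p) k = 2 →
        ¬ (galoisRepTorsion W p).range.map Φ.toMonoidHom ≤
            Subgroup.normalizer (unitGroup k : Set (GL (Fin 2) (ZMod p))) := by
  obtain ⟨e, Φ, he, -⟩ := exists_frame_galoisRepTorsion_rat W p
  exact ⟨e, Φ, he, fun k hk h2 ↦ not_le_normalizer_unitGroup_of_mult W p Φ e he h5 hmult hk h2⟩

end Summit.BirchSwinnertonDyer.Rank1Residual.GaloisImage

end
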